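import Mathlib
import Literature.MathematicalPhysics.StatisticalMechanics.BarlowStacking

/-!
# Admissible-window pin from the lattice series — stub `stub_pinFromSeries` of line `vanishing-excess-truss-rigidity` (crux `CoarseGrains`, stmt-AtomisticToContinuum-9331)

Assuming (A) the hcp energy per particle as the `ℤ³`-indexed Lennard-Jones series
`e(a,h) = ½ ∑' [v ≠ 0] V_LJ(√(a² Q v + k² h²))` (Blanc–Lewin 2015, §2.1 (23)) and (B) certified
numerics for the pure lattice sums `S n c = ∑' [v ≠ 0] (Q v + k² c²)⁻ⁿ`,
`D n c = ∑' [v ≠ 0] k² (Q v + k² c²)⁻ⁿ⁻¹`, a box point `(a,h)` of minimal hcp energy lies in the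
admissible window: `V_LJ(√x) = x⁻⁶/12 - x⁻³/6` gives `e(a, ac) = ½ (a⁻¹² S 6 c/12 - a⁻⁶ S 3 c/6)`;
the optimal dilation of shape `c'` gives `e(a,h) ≤ -(S 3 c')²/(24 S 6 c')`, whence
`a⁶ = S 6 c / S 3 c` (`c = h/a`) and shape maximality; Fermat in the layer spacing (termwise
differentiation) gives `S 6 c · D 3 c = S 3 c · D 6 c`; then (B) pins `a` and `h/√(2/3)`.
-/

noncomputable section

namespace Summit.AtomisticToContinuum.Crystallization.Theorems.ExcessDecayLiouvilleCoarseGrains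

open Literature.MathematicalPhysics.StatisticalMechanics

/-- `V_LJ(√x) = x⁻⁶/12 - x⁻³/6` for `x ≥ 0`. [folklore] -/
theorem hcpPinC_lennardJones_sqrt {x : ℝ} (hx : 0 ≤ x) :
    lennardJones (Real.sqrt x) = (1 / 12) * (x⁻¹) ^ 6 - (1 / 6) * (x⁻¹) ^ 3 := by
  have h2 : (Real.sqrt x)⁻¹ ^ 2 = x⁻¹ := by rw [inv_pow, Real.sq_sqrt hx]
  unfold lennardJones
  rw [← h2, ← pow_mul, ← pow_mul]

/-- The hcp form `Q (k,i,j) = i² + ij + j² + [k odd](i + j + 1/3)` is nonnegative. [folklore] -/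
theorem hcpPinC_Q_nonneg (v : ℤ × ℤ × ℤ) :
    0 ≤ (v.2.1 : ℝ) ^ 2 + (v.2.1 : ℝ) * v.2.2 + (v.2.2 : ℝ) ^ 2 +
        (if Even v.1 then 0 else ((v.2.1 : ℝ) + v.2.2 + 1 / 3)) := by
  split_ifs
  · nlinarith [sq_nonneg ((v.2.1 : ℝ) + v.2.2 / 2), sq_nonneg (v.2.2 : ℝ)]
  · nlinarith [sq_nonneg ((v.2.1 : ℝ) + v.2.2 / 2 + 1 / 2), sq_nonneg ((v.2.2 : ℝ) + 1 / 3)]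

/-- The hcp quadratic form is positive at the nonzero points of the layer `k = 0`. [folklore] -/
theorem hcpPinC_Q_pos (v : ℤ × ℤ × ℤ) (hv : v ≠ 0) (hk : v.1 = 0) :
    0 < (v.2.1 : ℝ) ^ 2 + (v.2.1 : ℝ) * v.2.2 + (v.2.2 : ℝ) ^ 2 +
        (if Even v.1 then 0 else ((v.2.1 : ℝ) + v.2.2 + 1 / 3)) := by
  obtain ⟨k, i, j⟩ := v
  dsimp only at hk ⊢
  subst hk
  rw [if_pos Even.zero, add_zero]
  have hij : ((i, j) : ℤ × ℤ) ≠ 0 := by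
    rintro h0; simp only [Prod.mk_eq_zero] at h0; obtain ⟨rfl, rfl⟩ := h0; exact hv rfl
  have h1 : (1 : ℝ) ≤ (i : ℝ) ^ 2 + (i : ℝ) * j + (j : ℝ) ^ 2 := by
    exact_mod_cast one_le_sq_add_mul_add_sq hij
  linarith

/-- `Q v + k² c² > 0` for `v ≠ 0`, `c ≠ 0`. [folklore] -/
theorem hcpPinC_p_pos {Q : ℤ × ℤ × ℤ → ℝ} (hQ0 : ∀ v, 0 ≤ Q v)
    (hQ1 : ∀ v : ℤ × ℤ × ℤ, v ≠ 0 → v.1 = 0 → 0 < Q v) {v : ℤ × ℤ × ℤ} (hv : v ≠ 0)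
    {c : ℝ} (hc : c ≠ 0) : 0 < Q v + (v.1 : ℝ) ^ 2 * c ^ 2 := by
  by_cases hk : v.1 = 0
  · simpa [hk] using hQ1 v hv hk
  · have hk' : (v.1 : ℝ) ≠ 0 := by exact_mod_cast hk
    have := hQ0 v
    positivity

/-- The lattice sums `S n c` are positive. [folklore] -/
theorem hcpPinC_tsum_pos {Q : ℤ × ℤ × ℤ → ℝ} (hQ0 : ∀ v, 0 ≤ Q v)
    (hQ1 : ∀ v : ℤ × ℤ × ℤ, v ≠ 0 → v.1 = 0 → 0 < Q v) {c : ℝ} (hc : c ≠ 0) (n : ℕ)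
    (hS : Summable fun v : ℤ × ℤ × ℤ =>
      if v = 0 then (0 : ℝ) else ((Q v + (v.1 : ℝ) ^ 2 * c ^ 2)⁻¹) ^ n) :
    0 < ∑' v : ℤ × ℤ × ℤ, if v = 0 then (0 : ℝ) else ((Q v + (v.1 : ℝ) ^ 2 * c ^ 2)⁻¹) ^ n := by
  refine hS.tsum_pos (fun v => ?_) ((1 : ℤ), (0 : ℤ), (0 : ℤ)) ?_
  · split_ifs with hv
    · exact le_rfl
    · exact pow_nonneg (inv_nonneg.2 (hcpPinC_p_pos hQ0 hQ1 hv hc).le) _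
  · rw [if_neg (by simp)]
    exact pow_pos (inv_pos.2 (hcpPinC_p_pos hQ0 hQ1 (by simp) hc)) _

/-- **Series split.** From the series representation (A) at `(a,h)`: the pure lattice sums
`S 3 (h/a)`, `S 6 (h/a)` converge and `e = ½ (a⁻¹² S 6 / 12 - a⁻⁶ S 3 / 6)`. [folklore] -/
theorem hcpPinC_energy_formula (Q : ℤ × ℤ × ℤ → ℝ) (hQ0 : ∀ v, 0 ≤ Q v) {a h e : ℝ}
    (ha : a ≠ 0)
    (hA1 : Summable fun v : ℤ × ℤ × ℤ =>
      if v = 0 then (0 : ℝ) else ((a ^ 2 * Q v + (v.1 : ℝ) ^ 2 * h ^ 2)⁻¹) ^ 3)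
    (hA2 : Summable fun v : ℤ × ℤ × ℤ =>
      if v = 0 then (0 : ℝ) else lennardJones (Real.sqrt (a ^ 2 * Q v + (v.1 : ℝ) ^ 2 * h ^ 2)))
    (hA3 : e = (1 / 2) * ∑' v : ℤ × ℤ × ℤ,
      if v = 0 then (0 : ℝ) else lennardJones (Real.sqrt (a ^ 2 * Q v + (v.1 : ℝ) ^ 2 * h ^ 2))) :
    (Summable fun v : ℤ × ℤ × ℤ =>
        if v = 0 then (0 : ℝ) else ((Q v + (v.1 : ℝ) ^ 2 * (h / a) ^ 2)⁻¹) ^ 3) ∧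
    (Summable fun v : ℤ × ℤ × ℤ =>
        if v = 0 then (0 : ℝ) else ((Q v + (v.1 : ℝ) ^ 2 * (h / a) ^ 2)⁻¹) ^ 6) ∧
    e = 1 / 2 * ((1 / 12) * (a ^ 12)⁻¹ * (∑' v : ℤ × ℤ × ℤ,
        if v = 0 then (0 : ℝ) else ((Q v + (v.1 : ℝ) ^ 2 * (h / a) ^ 2)⁻¹) ^ 6) -
      (1 / 6) * (a ^ 6)⁻¹ * (∑' v : ℤ × ℤ × ℤ,
        if v = 0 then (0 : ℝ) else ((Q v + (v.1 : ℝ) ^ 2 * (h / a) ^ 2)⁻¹) ^ 3)) := by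
  have hx : ∀ v : ℤ × ℤ × ℤ,
      a ^ 2 * Q v + (v.1 : ℝ) ^ 2 * h ^ 2 = a ^ 2 * (Q v + (v.1 : ℝ) ^ 2 * (h / a) ^ 2) := by
    intro v; field_simp
  set T3 : ℤ × ℤ × ℤ → ℝ := fun v =>
    if v = 0 then (0 : ℝ) else ((Q v + (v.1 : ℝ) ^ 2 * (h / a) ^ 2)⁻¹) ^ 3 with hT3
  set T6 : ℤ × ℤ × ℤ → ℝ := fun v =>
    if v = 0 then (0 : ℝ) else ((Q v + (v.1 : ℝ) ^ 2 * (h / a) ^ 2)⁻¹) ^ 6 with hT6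
  have h1 : (fun v : ℤ × ℤ × ℤ =>
      if v = 0 then (0 : ℝ) else ((a ^ 2 * Q v + (v.1 : ℝ) ^ 2 * h ^ 2)⁻¹) ^ 3) =
      fun v => (a ^ 6)⁻¹ * T3 v := by
    funext v
    simp only [hT3]
    split_ifs with hv
    · simp
    · rw [hx, mul_inv, mul_pow]
      ring
  have hL : (fun v : ℤ × ℤ × ℤ =>
      if v = 0 then (0 : ℝ) else lennardJones (Real.sqrt (a ^ 2 * Q v + (v.1 : ℝ) ^ 2 * h ^ 2))) =
      fun v => (1 / 12) * (a ^ 12)⁻¹ * T6 v - (1 / 6) * (a ^ 6)⁻¹ * T3 v := by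
    funext v
    simp only [hT3, hT6]
    split_ifs with hv
    · simp
    · have hQv := hQ0 v
      rw [hcpPinC_lennardJones_sqrt (by positivity), hx, mul_inv, mul_pow, mul_pow]
      ring
  rw [h1] at hA1
  rw [hL] at hA2 hA3
  have hs3 : Summable T3 := by
    refine (hA1.mul_left (a ^ 6)).congr fun v => ?_
    rw [← mul_assoc, mul_inv_cancel₀ (pow_ne_zero 6 ha), one_mul]
  have hs6 : Summable T6 := by
    refine ((hA2.add (hs3.mul_left ((1 / 6) * (a ^ 6)⁻¹))).mul_left (12 * a ^ 12)).congr
      fun v => ?_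
    rw [sub_add_cancel]
    field_simp
  refine ⟨hs3, hs6, ?_⟩
  rw [hA3, (hs6.mul_left _).tsum_sub (hs3.mul_left _), tsum_mul_left, tsum_mul_left]

/-- Value of the energy at the optimal dilation: if `b⁶ = S₆/S₃` then
`½ (b⁻¹² S₆ / 12 - b⁻⁶ S₃ / 6) = -S₃² / (24 S₆)`. [folklore] -/
theorem hcpPinC_dilation_value {s3 s6 b : ℝ} (h3 : 0 < s3) (h6 : 0 < s6)
    (hb : b ^ 6 = s6 / s3) :
    1 / 2 * ((1 / 12) * (b ^ 12)⁻¹ * s6 - (1 / 6) * (b ^ 6)⁻¹ * s3) = -(s3 ^ 2 / (24 * s6)) := by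
  have hb12 : b ^ 12 = (s6 / s3) ^ 2 := by rw [← hb]; ring
  rw [hb12, hb]
  field_simp
  ring

/-- The parabola argument: `f(a⁻⁶) ≤ min f` forces `a⁶ = S₆/S₃`. [folklore] -/
theorem hcpPinC_dilation_eq {s3 s6 a : ℝ} (h3 : 0 < s3) (h6 : 0 < s6) (ha : a ≠ 0)
    (hle : 1 / 2 * ((1 / 12) * (a ^ 12)⁻¹ * s6 - (1 / 6) * (a ^ 6)⁻¹ * s3) ≤
      -(s3 ^ 2 / (24 * s6))) :
    a ^ 6 = s6 / s3 := by
  have key : 1 / 2 * ((1 / 12) * (a ^ 12)⁻¹ * s6 - (1 / 6) * (a ^ 6)⁻¹ * s3) +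
      s3 ^ 2 / (24 * s6) = (s6 - s3 * a ^ 6) ^ 2 / (24 * s6 * a ^ 12) := by
    field_simp
    ring
  have hnum : (s6 - s3 * a ^ 6) ^ 2 / (24 * s6 * a ^ 12) ≤ 0 := by rw [← key]; linarith
  have hden : 0 < 24 * s6 * a ^ 12 := by positivity
  rw [div_le_iff₀ hden, zero_mul] at hnum
  have h0 : (s6 - s3 * a ^ 6) ^ 2 = 0 := le_antisymm hnum (sq_nonneg _)
  have h1 : s6 = s3 * a ^ 6 := sub_eq_zero.1 ((pow_eq_zero_iff two_ne_zero).1 h0)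
  rw [eq_div_iff h3.ne', mul_comm]
  exact h1.symm

/-- Shape comparison: `-(S₃²/(24 S₆)) ≤ -(S₃'²/(24 S₆'))` gives `S₃'²/S₆' ≤ S₃²/S₆`. [folklore] -/
theorem hcpPinC_shape_le {s3 s6 s3' s6' : ℝ} (h6 : 0 < s6) (h6' : 0 < s6')
    (hle : -(s3 ^ 2 / (24 * s6)) ≤ -(s3' ^ 2 / (24 * s6'))) :
    s3' ^ 2 / s6' ≤ s3 ^ 2 / s6 := by
  have e1 : s3' ^ 2 / s6' = 24 * (s3' ^ 2 / (24 * s6')) := by field_simp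
  have e2 : s3 ^ 2 / s6 = 24 * (s3 ^ 2 / (24 * s6)) := by field_simp
  rw [e1, e2]
  linarith

/-- Fermat algebra: `φ'(c) = 0` with `a⁶ = S₆/S₃` gives `S₆ D₃ = S₃ D₆`. [folklore] -/
theorem hcpPinC_fermat_alg {s3 s6 d3 d6 a c : ℝ} (h3 : 0 < s3) (ha : a ≠ 0) (hc : c ≠ 0)
    (ha6 : a ^ 6 = s6 / s3)
    (hz : 1 / 12 * (a ^ 12)⁻¹ * (-(2 * 6 * c) * d6) - 1 / 6 * (a ^ 6)⁻¹ * (-(2 * 3 * c) * d3)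
      = 0) :
    s6 * d3 = s3 * d6 := by
  have key : a ^ 6 * d3 - d6 =
      (1 / 12 * (a ^ 12)⁻¹ * (-(2 * 6 * c) * d6) - 1 / 6 * (a ^ 6)⁻¹ * (-(2 * 3 * c) * d3)) *
        (a ^ 12 / c) := by
    field_simp
    ring
  rw [hz, zero_mul, sub_eq_zero] at key
  rw [← key, ha6]
  field_simp

/-- Derivative of one term `[v ≠ 0] (Q v + k² y²)⁻ⁿ` in the layer-spacing ratio `y`. [folklore] -/
theorem hcpPinC_hasDerivAt_term (Q : ℤ × ℤ × ℤ → ℝ) (n : ℕ) (v : ℤ × ℤ × ℤ) {y : ℝ}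
    (hy : v ≠ 0 → Q v + (v.1 : ℝ) ^ 2 * y ^ 2 ≠ 0) :
    HasDerivAt (fun y : ℝ => if v = 0 then (0 : ℝ) else ((Q v + (v.1 : ℝ) ^ 2 * y ^ 2)⁻¹) ^ n)
      (-(2 * n * y) * (if v = 0 then (0 : ℝ) else
        (v.1 : ℝ) ^ 2 * ((Q v + (v.1 : ℝ) ^ 2 * y ^ 2)⁻¹) ^ (n + 1))) y := by
  by_cases hv : v = 0
  · simp only [hv, if_true, mul_zero]
    exact hasDerivAt_const _ _
  · simp only [hv, if_false]
    have hp := hy hv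
    have h1 : HasDerivAt (fun y : ℝ => Q v + (v.1 : ℝ) ^ 2 * y ^ 2)
        ((v.1 : ℝ) ^ 2 * (2 * y)) y := by
      simpa using ((hasDerivAt_pow 2 y).const_mul ((v.1 : ℝ) ^ 2)).const_add (Q v)
    refine ((h1.fun_inv hp).fun_pow n).congr_deriv ?_
    rcases n with _ | m
    · simp
    · rw [Nat.add_sub_cancel, Nat.cast_succ, div_eq_mul_inv, ← inv_pow]
      ring

/-- Uniform bound for the termwise derivatives on `y ∈ (c/2, 2c)`. [folklore] -/
theorem hcpPinC_deriv_bound {Q : ℤ × ℤ × ℤ → ℝ} (hQ0 : ∀ v, 0 ≤ Q v)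
    (hQ1 : ∀ v : ℤ × ℤ × ℤ, v ≠ 0 → v.1 = 0 → 0 < Q v) (n : ℕ) {c y : ℝ} (hc : 0 < c)
    (hy : y ∈ Set.Ioo (c / 2) (2 * c)) (v : ℤ × ℤ × ℤ) :
    ‖-(2 * n * y) * (if v = 0 then (0 : ℝ) else
        (v.1 : ℝ) ^ 2 * ((Q v + (v.1 : ℝ) ^ 2 * y ^ 2)⁻¹) ^ (n + 1))‖ ≤
      16 * n / c * (if v = 0 then (0 : ℝ) else ((Q v + (v.1 : ℝ) ^ 2 * (c / 2) ^ 2)⁻¹) ^ n) := by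
  by_cases hv : v = 0
  · simp [hv]
  · simp only [hv, if_false]
    have hy0 : 0 < y := lt_trans (half_pos hc) hy.1
    have hQv := hQ0 v
    have hp0 : 0 < Q v + (v.1 : ℝ) ^ 2 * (c / 2) ^ 2 := hcpPinC_p_pos hQ0 hQ1 hv (half_pos hc).ne'
    have hpy : Q v + (v.1 : ℝ) ^ 2 * (c / 2) ^ 2 ≤ Q v + (v.1 : ℝ) ^ 2 * y ^ 2 := by
      gcongr; exact hy.1.le
    have hpy0 : 0 < Q v + (v.1 : ℝ) ^ 2 * y ^ 2 := hp0.trans_le hpy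
    have hk : (v.1 : ℝ) ^ 2 * (Q v + (v.1 : ℝ) ^ 2 * y ^ 2)⁻¹ ≤ (y ^ 2)⁻¹ := by
      rw [← div_eq_mul_inv, ← one_div, div_le_div_iff₀ hpy0 (by positivity)]
      nlinarith
    rw [Real.norm_eq_abs, abs_mul, abs_neg, abs_of_nonneg (by positivity),
      abs_of_nonneg (by positivity)]
    calc 2 * n * y * ((v.1 : ℝ) ^ 2 * ((Q v + (v.1 : ℝ) ^ 2 * y ^ 2)⁻¹) ^ (n + 1))
        = 2 * n * y * (((v.1 : ℝ) ^ 2 * (Q v + (v.1 : ℝ) ^ 2 * y ^ 2)⁻¹) *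
            ((Q v + (v.1 : ℝ) ^ 2 * y ^ 2)⁻¹) ^ n) := by ring
      _ ≤ 2 * n * (2 * c) * ((y ^ 2)⁻¹ * ((Q v + (v.1 : ℝ) ^ 2 * (c / 2) ^ 2)⁻¹) ^ n) := by
          gcongr
          exact hy.2.le
      _ ≤ 2 * n * (2 * c) * (((c / 2) ^ 2)⁻¹ * ((Q v + (v.1 : ℝ) ^ 2 * (c / 2) ^ 2)⁻¹) ^ n) := by
          gcongr
          exact hy.1.le
      _ = 16 * n / c * ((Q v + (v.1 : ℝ) ^ 2 * (c / 2) ^ 2)⁻¹) ^ n := by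
          field_simp
          ring

/-- **Termwise differentiation** in the layer ratio: `(S n)' c = -2nc · D n c`. [folklore] -/
theorem hcpPinC_hasDerivAt_tsum {Q : ℤ × ℤ × ℤ → ℝ} (hQ0 : ∀ v, 0 ≤ Q v)
    (hQ1 : ∀ v : ℤ × ℤ × ℤ, v ≠ 0 → v.1 = 0 → 0 < Q v) (n : ℕ) {c : ℝ} (hc : 0 < c)
    (hhalf : Summable fun v : ℤ × ℤ × ℤ =>
      if v = 0 then (0 : ℝ) else ((Q v + (v.1 : ℝ) ^ 2 * (c / 2) ^ 2)⁻¹) ^ n)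
    (hcs : Summable fun v : ℤ × ℤ × ℤ =>
      if v = 0 then (0 : ℝ) else ((Q v + (v.1 : ℝ) ^ 2 * c ^ 2)⁻¹) ^ n) :
    HasDerivAt (fun y : ℝ => ∑' v : ℤ × ℤ × ℤ,
        if v = 0 then (0 : ℝ) else ((Q v + (v.1 : ℝ) ^ 2 * y ^ 2)⁻¹) ^ n)
      (-(2 * n * c) * ∑' v : ℤ × ℤ × ℤ,
        if v = 0 then (0 : ℝ) else
          (v.1 : ℝ) ^ 2 * ((Q v + (v.1 : ℝ) ^ 2 * c ^ 2)⁻¹) ^ (n + 1)) c := by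
  have hmem : c ∈ Set.Ioo (c / 2) (2 * c) := ⟨by linarith, by linarith⟩
  refine (hasDerivAt_tsum_of_isPreconnected (t := Set.Ioo (c / 2) (2 * c))
    (hhalf.mul_left (16 * n / c)) isOpen_Ioo isPreconnected_Ioo
    (fun v y hy => hcpPinC_hasDerivAt_term Q n v fun hv =>
      (hcpPinC_p_pos hQ0 hQ1 hv (lt_trans (half_pos hc) hy.1).ne').ne')
    (fun v y hy => hcpPinC_deriv_bound hQ0 hQ1 n hc hy v) hmem hcs hmem).congr_deriv ?_
  exact tsum_mul_left

/-- **Stub C of line `vanishing-excess-truss-rigidity`.** Assuming (A) the series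
representation of the hcp energy per particle (Blanc–Lewin 2015, §2.1 (23)) and (B) the
certified lattice-sum numerics, a box point `(a,h)` whose `hcp(a,h)` energy per particle is
minimal among all `hcp(a',h')` lies in the admissible window: series algebra, dilation
optimality `a⁶ = S 6 c / S 3 c`, shape maximality and Fermat in the layer spacing
`S 6 c · D 3 c = S 3 c · D 6 c` (`c = h/a`). [folklore] -/
theorem stub_pinFromSeries :
    (∀ (a h : ℝ) (ha : a ≠ 0) (hh : h ≠ 0),
      let Q : ℤ × ℤ × ℤ → ℝ := fun v => (v.2.1 : ℝ) ^ 2 + (v.2.1 : ℝ) * v.2.2 + (v.2.2 : ℝ) ^ 2 +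
        (if Even v.1 then 0 else ((v.2.1 : ℝ) + v.2.2 + 1 / 3))
      (Summable fun v : ℤ × ℤ × ℤ =>
          if v = 0 then (0 : ℝ) else ((a ^ 2 * Q v + (v.1 : ℝ) ^ 2 * h ^ 2)⁻¹) ^ 3) ∧
      (Summable fun v : ℤ × ℤ × ℤ =>
          if v = 0 then (0 : ℝ) else lennardJones (Real.sqrt (a ^ 2 * Q v + (v.1 : ℝ) ^ 2 * h ^ 2))) ∧
      (hcpPeriodicConfiguration ha hh).energyPerParticle lennardJones =
        (1 / 2) * ∑' v : ℤ × ℤ × ℤ,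
          if v = 0 then (0 : ℝ) else lennardJones (Real.sqrt (a ^ 2 * Q v + (v.1 : ℝ) ^ 2 * h ^ 2))) →
    (let Q : ℤ × ℤ × ℤ → ℝ := fun v => (v.2.1 : ℝ) ^ 2 + (v.2.1 : ℝ) * v.2.2 + (v.2.2 : ℝ) ^ 2 +
        (if Even v.1 then 0 else ((v.2.1 : ℝ) + v.2.2 + 1 / 3))
      let S : ℕ → ℝ → ℝ := fun n c => ∑' v : ℤ × ℤ × ℤ,
        if v = 0 then (0 : ℝ) else ((Q v + (v.1 : ℝ) ^ 2 * c ^ 2)⁻¹) ^ n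
      let D : ℕ → ℝ → ℝ := fun n c => ∑' v : ℤ × ℤ × ℤ,
        if v = 0 then (0 : ℝ) else (v.1 : ℝ) ^ 2 * ((Q v + (v.1 : ℝ) ^ 2 * c ^ 2)⁻¹) ^ (n + 1)
      ∀ c : ℝ, 39 / 50 ≤ c → c ≤ 17 / 20 →
        S 6 c * D 3 c = S 3 c * D 6 c →
        (∀ c' : ℝ, 39 / 50 ≤ c' → c' ≤ 17 / 20 → S 3 c' ^ 2 / S 6 c' ≤ S 3 c ^ 2 / S 6 c) →
        (189 / 200 : ℝ) ^ 6 ≤ S 6 c / S 3 c ∧ S 6 c / S 3 c ≤ (199 / 200 : ℝ) ^ 6 ∧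
        (189 / 200 : ℝ) ^ 6 ≤ 27 / 8 * c ^ 6 * (S 6 c / S 3 c) ∧
        27 / 8 * c ^ 6 * (S 6 c / S 3 c) ≤ (199 / 200 : ℝ) ^ 6) →
    ∀ (a h : ℝ) (ha : a ≠ 0) (hh : h ≠ 0), 47 / 50 ≤ a → a ≤ 1 → 39 / 50 * a ≤ h → h ≤ 17 / 20 * a →
    (∀ (a' h' : ℝ) (ha' : a' ≠ 0) (hh' : h' ≠ 0),
      (hcpPeriodicConfiguration ha hh).energyPerParticle lennardJones ≤
        (hcpPeriodicConfiguration ha' hh').energyPerParticle lennardJones) →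
    |a - 97 / 100| ≤ 1 / 40 ∧ |h / Real.sqrt (2 / 3) - 97 / 100| ≤ 1 / 40
 := by
  intro hA hB a h ha hh ha₁ _ hh₁ hh₂ hmin
  extract_lets Q S D at hB
  extract_lets at hA
  have hQ0 : ∀ v, 0 ≤ Q v := hcpPinC_Q_nonneg
  have hQ1 : ∀ v : ℤ × ℤ × ℤ, v ≠ 0 → v.1 = 0 → 0 < Q v := hcpPinC_Q_pos
  have ha0 : 0 < a := by linarith
  obtain ⟨c, rfl⟩ : ∃ c, h = a * c := ⟨h / a, by field_simp⟩
  have hc1 : 39 / 50 ≤ c := le_of_mul_le_mul_right (hh₁.trans_eq (mul_comm a c)) ha0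
  have hc2 : c ≤ 17 / 20 := le_of_mul_le_mul_right ((mul_comm c a).trans_le hh₂) ha0
  have hc0 : 0 < c := by linarith
  have hcne : c ≠ 0 := hc0.ne'
  -- summability and positivity of the pure lattice sums, from (A) at `(1, c')`
  have hT : ∀ c' : ℝ, c' ≠ 0 →
      (Summable fun v : ℤ × ℤ × ℤ =>
        if v = 0 then (0 : ℝ) else ((Q v + (v.1 : ℝ) ^ 2 * c' ^ 2)⁻¹) ^ 3) ∧
      (Summable fun v : ℤ × ℤ × ℤ =>
        if v = 0 then (0 : ℝ) else ((Q v + (v.1 : ℝ) ^ 2 * c' ^ 2)⁻¹) ^ 6) := by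
    intro c' hc'
    obtain ⟨h1, h2, h3⟩ := hA 1 c' one_ne_zero hc'
    have key := hcpPinC_energy_formula Q hQ0 one_ne_zero h1 h2 h3
    rw [div_one] at key
    exact ⟨key.1, key.2.1⟩
  have hSpos : ∀ (n : ℕ) (c' : ℝ), c' ≠ 0 →
      (Summable fun v : ℤ × ℤ × ℤ =>
        if v = 0 then (0 : ℝ) else ((Q v + (v.1 : ℝ) ^ 2 * c' ^ 2)⁻¹) ^ n) → 0 < S n c' :=
    fun n c' hc' hs => hcpPinC_tsum_pos hQ0 hQ1 hc' n hs
  -- the energy per particle of `hcp(a', a' c')`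
  have hE : ∀ (a' c' : ℝ) (ha' : a' ≠ 0) (hh' : a' * c' ≠ 0),
      (hcpPeriodicConfiguration ha' hh').energyPerParticle lennardJones =
        1 / 2 * ((1 / 12) * (a' ^ 12)⁻¹ * S 6 c' - (1 / 6) * (a' ^ 6)⁻¹ * S 3 c') := by
    intro a' c' ha' hh'
    obtain ⟨h1, h2, h3⟩ := hA a' (a' * c') ha' hh'
    have key := (hcpPinC_energy_formula Q hQ0 ha' h1 h2 h3).2.2
    rw [mul_div_cancel_left₀ c' ha'] at key
    exact key
  -- comparison with the optimally dilated hcp of shape `c'`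
  have hI : ∀ c' : ℝ, c' ≠ 0 →
      (hcpPeriodicConfiguration ha hh).energyPerParticle lennardJones ≤
        -(S 3 c' ^ 2 / (24 * S 6 c')) := by
    intro c' hc'
    have h3 := hSpos 3 c' hc' (hT c' hc').1
    have h6 := hSpos 6 c' hc' (hT c' hc').2
    have hq : 0 < S 6 c' / S 3 c' := div_pos h6 h3
    obtain ⟨b, hb0, hb6⟩ : ∃ b : ℝ, 0 < b ∧ b ^ 6 = S 6 c' / S 3 c' :=
      ⟨(S 6 c' / S 3 c') ^ ((6 : ℕ) : ℝ)⁻¹, Real.rpow_pos_of_pos hq _,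
        Real.rpow_inv_natCast_pow hq.le (by norm_num)⟩
    have key := hmin b (b * c') hb0.ne' (mul_ne_zero hb0.ne' hc')
    rw [hE b c' hb0.ne' (mul_ne_zero hb0.ne' hc'), hcpPinC_dilation_value h3 h6 hb6] at key
    exact key
  -- consequences at `(a, h)`: `a⁶ = S 6 c / S 3 c`, the energy value, shape maximality
  have hS3 := hSpos 3 c hcne (hT c hcne).1
  have hS6 := hSpos 6 c hcne (hT c hcne).2
  have he := hE a c ha hh
  have ha6 : a ^ 6 = S 6 c / S 3 c :=
    hcpPinC_dilation_eq hS3 hS6 ha (by rw [← he]; exact hI c hcne)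
  have he' : (hcpPeriodicConfiguration ha hh).energyPerParticle lennardJones =
      -(S 3 c ^ 2 / (24 * S 6 c)) := by
    rw [he]
    exact hcpPinC_dilation_value hS3 hS6 ha6
  have hshape : ∀ c' : ℝ, 39 / 50 ≤ c' → c' ≤ 17 / 20 →
      S 3 c' ^ 2 / S 6 c' ≤ S 3 c ^ 2 / S 6 c := by
    intro c' h1 _
    have hc' : c' ≠ 0 := (by linarith : (0 : ℝ) < c').ne'
    have key := hI c' hc'
    rw [he'] at key
    exact hcpPinC_shape_le hS6 (hSpos 6 c' hc' (hT c' hc').2) key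
  -- Fermat in the layer spacing
  have hderiv : ∀ n : ℕ, (∀ c' : ℝ, c' ≠ 0 → Summable fun v : ℤ × ℤ × ℤ =>
        if v = 0 then (0 : ℝ) else ((Q v + (v.1 : ℝ) ^ 2 * c' ^ 2)⁻¹) ^ n) →
      HasDerivAt (S n) (-(2 * n * c) * D n c) c := fun n hsum =>
    hcpPinC_hasDerivAt_tsum hQ0 hQ1 n hc0 (hsum _ (half_pos hc0).ne') (hsum _ hcne)
  have hd3 := hderiv 3 fun c' hc' => (hT c' hc').1
  have hd6 := hderiv 6 fun c' hc' => (hT c' hc').2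
  have hφ := (hd6.const_mul (1 / 12 * (a ^ 12)⁻¹)).sub (hd3.const_mul (1 / 6 * (a ^ 6)⁻¹))
  have hloc : IsLocalMin (fun y => 1 / 12 * (a ^ 12)⁻¹ * S 6 y - 1 / 6 * (a ^ 6)⁻¹ * S 3 y)
      c := by
    filter_upwards [Ioi_mem_nhds hc0] with y hy
    have hy0 : (0 : ℝ) < y := hy
    have key := hmin a (a * y) ha (mul_ne_zero ha hy0.ne')
    rw [he, hE a y ha (mul_ne_zero ha hy0.ne')] at key
    linarith
  have hzero := hloc.hasDerivAt_eq_zero hφ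
  push_cast at hzero
  have hferm : S 6 c * D 3 c = S 3 c * D 6 c :=
    hcpPinC_fermat_alg hS3 ha hcne ha6 (by linarith)
  -- conclude from the numerics (B)
  obtain ⟨hb1, hb2, hb3, hb4⟩ := hB c hc1 hc2 hferm hshape
  rw [← ha6] at hb1 hb2 hb3 hb4
  have h6 : (6 : ℕ) ≠ 0 := by norm_num
  have ha_lo : 189 / 200 ≤ a := (pow_le_pow_iff_left₀ (by norm_num) ha0.le h6).1 hb1
  have ha_hi : a ≤ 199 / 200 := (pow_le_pow_iff_left₀ ha0.le (by norm_num) h6).1 hb2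
  have hr : (a * c / Real.sqrt (2 / 3)) ^ 6 = 27 / 8 * c ^ 6 * a ^ 6 := by
    rw [div_pow, show Real.sqrt (2 / 3) ^ 6 = (Real.sqrt (2 / 3) ^ 2) ^ 3 by ring,
      Real.sq_sqrt (by norm_num : (0 : ℝ) ≤ 2 / 3)]
    ring
  have hr0 : 0 ≤ a * c / Real.sqrt (2 / 3) := by positivity
  have hr_lo : 189 / 200 ≤ a * c / Real.sqrt (2 / 3) :=
    (pow_le_pow_iff_left₀ (by norm_num) hr0 h6).1 (by rw [hr]; exact hb3)
  have hr_hi : a * c / Real.sqrt (2 / 3) ≤ 199 / 200 :=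
    (pow_le_pow_iff_left₀ hr0 (by norm_num) h6).1 (by rw [hr]; exact hb4)
  exact ⟨abs_sub_le_iff.2 ⟨by linarith, by linarith⟩, abs_sub_le_iff.2 ⟨by linarith, by linarith⟩⟩

end Summit.AtomisticToContinuum.Crystallization.Theorems.ExcessDecayLiouvilleCoarseGrains

end
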